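import Summits.QuantumFields.QCD.Theses.HeatSlicedQuarks
import Literature.MathematicalPhysics.QuantumLattice.WilsonDiracRangeOne
import Literature.MathematicalPhysics.QuantumLattice.LatticeToriProofs

/-!
# Crux `InterleavedFlowProper` (stmt-QuantumFields-18031), line `Sketch` — stub `stub_polynomialFiniteRange`:
# polynomials of degree `n` in `H_U = D_Wᴴ D_W` have exact finite range `2n`

Registered stub of the gen-3 skeleton `Cruxes/InterleavedFlowProper/Lines/Sketch.lean` (namespace
`Summit.QuantumFields.QCD.Cruxes.InterleavedFlowProper.OffsetLastFormatHandover`), the one provable input of K1b: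

  `stub_polynomialFiniteRange : ∀ L [NeZero L] U m p x y, 2 * p.natDegree < torusDist x.1 y.1 →
      (Polynomial.aeval (D_Wᴴ * D_W) p) x y = 0`,  `D_W := wilsonDirac (fundamentalRep (Fin 3)) U m 1`.

This is the exact-finite-range mechanism behind every lattice finite-range decomposition of the quark Green form
(Bauerschmidt, PTRF 157 (2013), condition (P*_{θ,B}) with `θ(n) = 2n`: "polynomials of degree `n` in the generator
have range `θ(n)`"), for the generator `H_U` of the engine's heat slices.

Proof.  The Wilson–Dirac matrix at `r = 1` couples only equal or nearest-neighbour sites in the periodic `ℓ^∞`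
distance (`torusDist_le_one_of_wilsonDirac_ne_zero`, tree file `WilsonDiracRangeOne`), hence so does its conjugate
transpose (symmetry `torusDist_comm'`), hence `H_U = D_Wᴴ D_W` has range `2` (triangle inequality
`torusDist_triangle'`).  A generic lemma on square matrices over a finite index type carrying an `ℕ`-valued
"distance" with `d a a = 0` and the triangle inequality gives `(A ^ n) a b ≠ 0 → d a b ≤ R * n` for a range-`R`
matrix `A` (induction on `n`, `Matrix.mul_apply`, a nonzero sum has a nonzero summand), and then
`Polynomial.aeval A p = ∑_{i ≤ natDegree p} coeff p i • A ^ i` (`Polynomial.aeval_eq_sum_range`) vanishes entrywise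
beyond distance `R * natDegree p`.  No named facts; everything used is proved tree material or Mathlib.
-/

namespace Summit.QuantumFields.QCD.Cruxes.InterleavedFlowProper.OffsetLastFormatHandover

open Literature.MathematicalPhysics.QuantumFieldTheory Literature.MathematicalPhysics.QuantumLattice
open Literature.Probability.LatticeModels (TorusSite)
open scoped Matrix

/-! ## §1 Generic: powers and polynomials of a finite-range matrix have finite range -/

/-- **Powers of a range-`R` matrix have range `R n`.**  For an `ℕ`-valued "distance" `d` on a finite index type with
`d a a = 0` and the triangle inequality, if `A a b ≠ 0 → d a b ≤ R` then `(A ^ n) a b ≠ 0 → d a b ≤ R * n`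
("the entries of `A ^ n` are sums over paths of `n` hops").
-- adapted from `Literature.Barriers.QuantumFields.HoppingExpansion.pow_apply_eq_zero_of_lt` (range one). -/
private theorem dist_le_of_pow_apply_ne_zero {ι : Type*} [Fintype ι] [DecidableEq ι] (d : ι → ι → ℕ)
    (hd0 : ∀ a, d a a = 0) (htri : ∀ a b c, d a c ≤ d a b + d b c) (A : Matrix ι ι ℂ) (R : ℕ)
    (hA : ∀ a b, A a b ≠ 0 → d a b ≤ R) :
    ∀ (n : ℕ) (a b : ι), (A ^ n) a b ≠ 0 → d a b ≤ R * n := by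
  intro n
  induction n with
  | zero =>
      intro a b h
      have hab : a = b := by
        by_contra hab
        exact h (by rw [pow_zero, Matrix.one_apply_ne hab])
      subst hab
      rw [hd0]
      exact Nat.zero_le _
  | succ n ih =>
      intro a b h
      rw [pow_succ, Matrix.mul_apply] at h
      obtain ⟨c, -, hc⟩ := Finset.exists_ne_zero_of_sum_ne_zero h
      calc d a b ≤ d a c + d c b := htri a c b
        _ ≤ R * n + R := add_le_add (ih a c (left_ne_zero_of_mul hc)) (hA c b (right_ne_zero_of_mul hc))
        _ = R * (n + 1) := by ring

/-- **Polynomials of degree `k` in a range-`R` matrix have range `R k`**: under the hypotheses of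
`dist_le_of_pow_apply_ne_zero`, `(Polynomial.aeval A p) a b = 0` whenever `R * natDegree p < d a b`. -/
private theorem aeval_apply_eq_zero_of_lt {ι : Type*} [Fintype ι] [DecidableEq ι] (d : ι → ι → ℕ)
    (hd0 : ∀ a, d a a = 0) (htri : ∀ a b c, d a c ≤ d a b + d b c) (A : Matrix ι ι ℂ) (R : ℕ)
    (hA : ∀ a b, A a b ≠ 0 → d a b ≤ R) (p : Polynomial ℂ) (a b : ι) (hlt : R * p.natDegree < d a b) :
    (Polynomial.aeval A p) a b = 0 := by
  rw [Polynomial.aeval_eq_sum_range, Matrix.sum_apply]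
  refine Finset.sum_eq_zero fun i hi => ?_
  have hi' : i ≤ p.natDegree := Nat.lt_succ_iff.mp (Finset.mem_range.mp hi)
  have hpow : (A ^ i) a b = 0 := by
    by_contra hne
    have h1 : d a b ≤ R * i := dist_le_of_pow_apply_ne_zero d hd0 htri A R hA i a b hne
    have h2 : R * i ≤ R * p.natDegree := Nat.mul_le_mul_left R hi'
    omega
  rw [Matrix.smul_apply, hpow, smul_zero]

/-! ## §2 The registered stub -/

/-- **Chebyshev finite range** (registered stub `stub_polynomialFiniteRange` of line `Sketch`):
`H_U = D_W(U,m,1)ᴴ D_W(U,m,1)` hops at most twice in the periodic `ℓ^∞` distance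
(`torusDist_le_one_of_wilsonDirac_ne_zero`, `torusDist_comm'`, `torusDist_triangle'`), so a polynomial of degree `k`
in `H_U` vanishes entrywise beyond torus distance `2k` — the exact-finite-range mechanism of every lattice
finite-range decomposition (Bauerschmidt 2013, condition (P*_{θ,B}) with `θ(n) = 2n`). -/
theorem stub_polynomialFiniteRange :
    ∀ (L : ℕ) [NeZero L] (U : GaugeConfig 4 L (Matrix.specialUnitaryGroup (Fin 3) ℂ)) (m : ℝ)
      (p : Polynomial ℂ) (x y : TorusSite 4 L × Fin 3 × Fin 4),
      2 * p.natDegree < torusDist x.1 y.1 →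
        (Polynomial.aeval ((wilsonDirac (fundamentalRep (Fin 3)) U m 1)ᴴ * wilsonDirac (fundamentalRep (Fin 3)) U m 1) p)
          x y = 0 := by
  intro L _ U m p x y hlt
  refine aeval_apply_eq_zero_of_lt (fun a b : TorusSite 4 L × Fin 3 × Fin 4 => torusDist a.1 b.1)
    (fun a => torusDist_self a.1) (fun a b c => torusDist_triangle' a.1 b.1 c.1) _ 2 ?_ p x y hlt
  intro a b hH
  rw [Matrix.mul_apply] at hH
  obtain ⟨c, -, hc⟩ := Finset.exists_ne_zero_of_sum_ne_zero hH
  have h1 : (wilsonDirac (fundamentalRep (Fin 3)) U m 1)ᴴ a c ≠ 0 := left_ne_zero_of_mul hc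
  have h2 : wilsonDirac (fundamentalRep (Fin 3)) U m 1 c b ≠ 0 := right_ne_zero_of_mul hc
  rw [Matrix.conjTranspose_apply, star_ne_zero] at h1
  have d1 : torusDist c.1 a.1 ≤ 1 :=
    torusDist_le_one_of_wilsonDirac_ne_zero (fundamentalRep (Fin 3)) fundamentalRep_mem_unitaryGroup U m c a h1
  have d2 : torusDist c.1 b.1 ≤ 1 :=
    torusDist_le_one_of_wilsonDirac_ne_zero (fundamentalRep (Fin 3)) fundamentalRep_mem_unitaryGroup U m c b h2
  rw [torusDist_comm'] at d1
  calc torusDist a.1 b.1 ≤ torusDist a.1 c.1 + torusDist c.1 b.1 := torusDist_triangle' _ _ _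
    _ ≤ 1 + 1 := add_le_add d1 d2
    _ = 2 := rfl

end Summit.QuantumFields.QCD.Cruxes.InterleavedFlowProper.OffsetLastFormatHandover
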